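import Summits.KontsevichZagierPeriods.Zeta5Search.LaiSweepShard

/-!
# `κ₃` sweep certificate — shard file 053 of 127 (shards 371–377 of 889)

HONEST FRAMING. Systematic search; no irrationality claim unless certified. This file only checks,
by `decide +kernel`, shards 371–377 of the order-cell sweep of the `κ₃` point `(74, 2180, 444; δ74)`
(engine `LaiSweepEngine`, soundness `LaiSweepJump/Free/Eval/Shard/Kappa3`; a shard is `⟨regime, n,
p, q, p', q', Lo, Up⟩`: `n` cells from `p/q` to `p'/q'` with integer rate sums in `[Lo, Up]`, `K =
128`, `D = 2^40`). It draws NO conclusion: only the capstone `LaiKappa3SweepCert`, which needs all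
127 shard files, does. Kernel cost of this file ≈ 560 cells × 0.3 s.
-/

namespace Summit.KontsevichZagierPeriods.Zeta5Search.Sweep

set_option maxHeartbeats 100000000 in
/-- Shard 371: 80 cells of regime B from `144/413` to `134/383`.
[cite: Lai2024BallRivoal, §4 Lemma 4.3] -/
theorem shard371 :
    Shard.check 128 (2^40)
      ⟨true, 80, 144, 413, 134, 383, 19017507349527, 20926536743989⟩ = true := by
  decide +kernel

set_option maxHeartbeats 100000000 in
/-- Shard 372: 80 cells of regime B from `134/383` to `105/299`.
[cite: Lai2024BallRivoal, §4 Lemma 4.3] -/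
theorem shard372 :
    Shard.check 128 (2^40)
      ⟨true, 80, 134, 383, 105, 299, 20535421641881, 22613820282035⟩ = true := by
  decide +kernel

set_option maxHeartbeats 100000000 in
/-- Shard 373: 80 cells of regime B from `105/299` to `123/349`.
[cite: Lai2024BallRivoal, §4 Lemma 4.3] -/
theorem shard373 :
    Shard.check 128 (2^40)
      ⟨true, 80, 105, 299, 123, 349, 19901009416132, 21931121539688⟩ = true := by
  decide +kernel

set_option maxHeartbeats 100000000 in
/-- Shard 374: 80 cells of regime B from `123/349` to `110/311`.
[cite: Lai2024BallRivoal, §4 Lemma 4.3] -/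
theorem shard374 :
    Shard.check 128 (2^40)
      ⟨true, 80, 123, 349, 110, 311, 19803474688280, 21840148215700⟩ = true := by
  decide +kernel

set_option maxHeartbeats 100000000 in
/-- Shard 375: 80 cells of regime B from `110/311` to `93/262`.
[cite: Lai2024BallRivoal, §4 Lemma 4.3] -/
theorem shard375 :
    Shard.check 128 (2^40)
      ⟨true, 80, 110, 311, 93, 262, 19758128790828, 21806035789296⟩ = true := by
  decide +kernel

set_option maxHeartbeats 100000000 in
/-- Shard 376: 80 cells of regime B from `93/262` to `109/306`.
[cite: Lai2024BallRivoal, §4 Lemma 4.3] -/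
theorem shard376 :
    Shard.check 128 (2^40)
      ⟨true, 80, 93, 262, 109, 306, 19467105491534, 21500405614255⟩ = true := by
  decide +kernel

set_option maxHeartbeats 100000000 in
/-- Shard 377: 80 cells of regime B from `109/306` to `69/193`.
[cite: Lai2024BallRivoal, §4 Lemma 4.3] -/
theorem shard377 :
    Shard.check 128 (2^40)
      ⟨true, 80, 109, 306, 69, 193, 20263752002991, 22398068930873⟩ = true := by
  decide +kernel

/-- The checked shards of this file, in order. [folklore] -/
def shards053 : List (CheckedShard 128 (2^40)) :=
  [⟨_, shard371⟩, ⟨_, shard372⟩, ⟨_, shard373⟩, ⟨_, shard374⟩, ⟨_, shard375⟩,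
    ⟨_, shard376⟩, ⟨_, shard377⟩]

end Summit.KontsevichZagierPeriods.Zeta5Search.Sweep
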